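import Literature.NumberTheory.Transcendental.GammaAbsorption
import Literature.NumberTheory.Transcendental.GammaRelativeNormalisation
import HarnessLib

/-!
# Bays–Kirby 2018, Prop. 11.2: GSΓC gives `ℵ₀`-saturation for Γ-algebraic extensions over `K`

M. Bays, J. Kirby, *Pseudo-exponential maps, variants, and quasiminimality*, Algebra & Number
Theory 12 (2018), Prop. 11.2 (with the proof of Thm 11.6 and of Lemma 8.3): the named fact
`Literature.NumberTheory.Transcendental.BaysKirby2018_prop_11_2` of `ZilberGenericClosedness.lean` is **proved**
(`Literature.NumberTheory.Transcendental.BaysKirby2018_prop_11_2_holds`). Together with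
`ZilberQuasiminimalReduction.isQuasiminimal_of_isExpAlgClosed_of_props` this reduces
Bays–Kirby's Theorem 1.5 (`ℂ_exp` exponentially-algebraically closed ⟹ quasiminimal,
`Literature.NumberTheory.Transcendental.isQuasiminimal_of_isExpAlgClosed`) to Prop. 11.5 alone.

The proof is an induction on the linear dimension `n` of the Γ-algebraic extension
`B = A + ℚe` over `A = K + ℚc` (after extracting bases), with the invariant recorded by the
*core output*: tuples `T ↦ T'` Γ-isomorphic over `K` whose span contains `c` and a basis `u` of
`B` over `A`, with transport sending `c ↦ c'`, and with the transport image of `B` strong in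
`F`.

* **Case 1** (some `x ∈ B ∖ A` is algebraic over `Γ(A)`, or has `exp x` algebraic): extend the
  Γ-isomorphism by `x` (`GammaIsoAlgebraicStep.lean`, `GammaIsoLogStep.lean` — Lemma 3.26 /
  Prop. 3.22 with the field-theoretic homogeneity Prop. 6.6 replaced by algebraic closedness of
  `F`, and surjectivity of `exp`), pass to a basis of `B` over `A + ℚx` and recurse.
* **Case 2** (no such `x`): absorb the relative algebraic closure into the base
  (`GammaAbsorption.lean`); if Case 1 now applies, recurse; otherwise normalise the basis
  (`GammaRelativeNormalisation.lean`, Prop. 3.24) and apply the geometric step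
  (`GammaGeometricStep.lean`: generic strong Γ-closedness, Def. 11.1, to the absolutely
  irreducible `Z(θ(loc))`, genericity, relative Kummer theory). Strongness of the transport
  image of `B` descends from the larger strong space along the absorbed algebraic chain
  (`GammaStrongDescent.lean`).

## References

* M. Bays, J. Kirby, *Pseudo-exponential maps, variants, and quasiminimality*, Algebra & Number
  Theory 12 (2018) 493–549: §3.3, Lemma 3.26, §4, Cor. 7.4, Lemma 8.3, Def. 11.1, Prop. 11.2,
  Thm 11.6.
-/

noncomputable section

open Set

universe u

namespace Literature.NumberTheory.Transcendental

namespace GammaField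

open Literature.ModelTheory.ExponentialFields.ExponentialRing ZilberSaturationMain
  Literature.FieldTheory.Regular Literature.FieldTheory.Kummer

variable {F : Type u} [Field F] [CharZero F] [Literature.ModelTheory.ExponentialFields.ExponentialRing F]
variable {K : Submodule ℚ F} {N n : ℕ}

/-! ### Transport of spans and tuples -/

/-- Transport of a linear combination of elements of `K + ℚT`. [folklore] -/
theorem IsGammaIso.transport_sum_smul {m a : ℕ} {T T' : Fin m → F} (H : IsGammaIso K T T')
    {y : Fin a → F} (hy : ∀ i, y i ∈ K ⊔ Submodule.span ℚ (range T)) (q : Fin a → ℚ) :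
    H.transport (∑ i, q i • y i) = ∑ i, q i • H.transport (y i) := by
  classical
  induction (Finset.univ : Finset (Fin a)) using Finset.induction_on with
  | empty => simp [H.transport_of_mem K.zero_mem]
  | insert i s hi ih =>
    rw [Finset.sum_insert hi, Finset.sum_insert hi, H.transport_add (Submodule.smul_mem _ _ (hy i))
      (Submodule.sum_mem _ fun j _ => Submodule.smul_mem _ _ (hy j)), H.transport_smul _ (hy i), ih]

/-- The transport image of `K + ℚy` only depends on the subspace `K + ℚy`. [folklore] -/
theorem IsGammaIso.sup_span_transport_le {m a b : ℕ} {T T' : Fin m → F} (H : IsGammaIso K T T')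
    {y : Fin a → F} {y' : Fin b → F}
    (hy' : ∀ i, y' i ∈ K ⊔ Submodule.span ℚ (range T))
    (hle : K ⊔ Submodule.span ℚ (range y) ≤ K ⊔ Submodule.span ℚ (range y')) :
    K ⊔ Submodule.span ℚ (range fun i => H.transport (y i)) ≤
      K ⊔ Submodule.span ℚ (range fun i => H.transport (y' i)) := by
  refine sup_le le_sup_left (Submodule.span_le.2 ?_)
  rintro _ ⟨i, rfl⟩
  have hyi : y i ∈ K ⊔ Submodule.span ℚ (range y') :=
    hle (Submodule.mem_sup_right (Submodule.subset_span ⟨i, rfl⟩))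
  obtain ⟨κ, hκ, w, hw, hsum⟩ := Submodule.mem_sup.1 hyi
  obtain ⟨q, rfl⟩ := (Submodule.mem_span_range_iff_exists_fun ℚ).1 hw
  show H.transport (y i) ∈ _
  rw [← hsum, H.transport_add (Submodule.mem_sup_left hκ)
    (Submodule.sum_mem _ fun j _ => Submodule.smul_mem _ _ (hy' j)), H.transport_of_mem hκ,
    H.transport_sum_smul hy' q]
  exact add_mem (Submodule.mem_sup_left hκ) (Submodule.mem_sup_right (Submodule.sum_mem _ fun j _ =>
    Submodule.smul_mem _ _ (Submodule.subset_span ⟨j, rfl⟩)))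

/-- The transport image of `K + ℚy` only depends on the subspace `K + ℚy`. [folklore] -/
theorem IsGammaIso.sup_span_transport_comp_eq {m a b : ℕ} {T T' : Fin m → F} (H : IsGammaIso K T T')
    {y : Fin a → F} {y' : Fin b → F} (hy : ∀ i, y i ∈ K ⊔ Submodule.span ℚ (range T))
    (hy' : ∀ i, y' i ∈ K ⊔ Submodule.span ℚ (range T))
    (heq : K ⊔ Submodule.span ℚ (range y) = K ⊔ Submodule.span ℚ (range y')) :
    K ⊔ Submodule.span ℚ (range fun i => H.transport (y i)) =
      K ⊔ Submodule.span ℚ (range fun i => H.transport (y' i)) :=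
  le_antisymm (H.sup_span_transport_le hy' heq.le) (H.sup_span_transport_le hy heq.ge)

/-- Applying a function to `Fin.append`. [folklore] -/
theorem transport_append_eq {α β : Type*} {a b : ℕ} (f : α → β) (v : Fin a → α) (w : Fin b → α) :
    (fun j => f (Fin.append v w j)) = Fin.append (fun i => f (v i)) (fun i => f (w i)) := by
  funext j
  refine Fin.addCases (fun i => ?_) (fun i => ?_) j
  · simp
  · simp

/-! ### Pulling the conclusion back along an absorption (descent of strongness) -/

set_option maxHeartbeats 400000 in
/-- **Descent along the absorbed chain.** In the situation of `exists_absorb` (base `c`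
enlarged by `x̄` algebraic over `Γ(A)`, linearly independent over `B = A + ℚu`), a Γ-isomorphism
`T ↦ T'` whose span contains `(c, x̄, u)`, with transport `(c, x̄) ↦ (c', x̄')` and with the
transport image of `B + ℚx̄` strong, already has the transport image of `B` strong
(`GammaField.IsStrong.of_sup_span_chain`: the transports of the `x̄ⱼ` form an algebraic chain
over it, by invariance of `td` and `δ` under Γ-isomorphisms).
[cite: BaysKirby2018ANT, Lemma 8.3 (proof), Lemma 4.2] -/
theorem corestep_of_absorb {c c' : Fin N → F} (hc : LinIndepOver K c)
    (hs : IsStrong (K ⊔ Submodule.span ℚ (range c))) {u : Fin n → F}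
    (hu : LinIndepOver (K ⊔ Submodule.span ℚ (range c)) u)
    (htd : td (K ⊔ Submodule.span ℚ (range c)) (Submodule.span ℚ (range u)) = n)
    {s : ℕ} {x x' : Fin s → F}
    (hxacl : ∀ j, x j ∈ acl (gens (K ⊔ Submodule.span ℚ (range c))))
    (hxind : LinIndepOver ((K ⊔ Submodule.span ℚ (range c)) ⊔ Submodule.span ℚ (range u)) x)
    {m : ℕ} {T T' : Fin m → F} (H : IsGammaIso K T T')
    (hcT : ∀ i, Fin.append c x i ∈ K ⊔ Submodule.span ℚ (range T))
    (huT : ∀ j, u j ∈ K ⊔ Submodule.span ℚ (range T))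
    (hTc : ∀ i, H.transport (Fin.append c x i) = Fin.append c' x' i)
    (hstrong : IsStrong (K ⊔ Submodule.span ℚ (range fun j => H.transport (Fin.append (Fin.append c x) u j)))) :
    ∃ (m : ℕ) (T T' : Fin m → F) (H : IsGammaIso K T T'),
      (∀ i, c i ∈ K ⊔ Submodule.span ℚ (range T)) ∧ (∀ j, u j ∈ K ⊔ Submodule.span ℚ (range T)) ∧
      (∀ i, H.transport (c i) = c' i) ∧
      IsStrong (K ⊔ Submodule.span ℚ (range fun j => H.transport (Fin.append c u j))) := by
  classical
  have hcT' : ∀ i, c i ∈ K ⊔ Submodule.span ℚ (range T) := fun i => by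
    simpa only [Fin.append_left] using hcT (Fin.castAdd s i)
  have hxT : ∀ j, x j ∈ K ⊔ Submodule.span ℚ (range T) := fun j => by
    simpa only [Fin.append_right] using hcT (Fin.natAdd N j)
  refine ⟨m, T, T', H, hcT', huT, fun i => ?_, ?_⟩
  · have := hTc (Fin.castAdd s i)
    simpa only [Fin.append_left] using this
  -- notation-free abbreviations
  have hcu : ∀ j, Fin.append c u j ∈ K ⊔ Submodule.span ℚ (range T) := by
    intro j; refine Fin.addCases (fun i => ?_) (fun i => ?_) j
    · simpa only [Fin.append_left] using hcT' i
    · simpa only [Fin.append_right] using huT i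
  have hB : IsStrong ((K ⊔ Submodule.span ℚ (range c)) ⊔ Submodule.span ℚ (range u)) := by
    have hfgu : IsFG (K ⊔ Submodule.span ℚ (range c)) (Submodule.span ℚ (range u)) :=
      isFG_span_of_finite _ (finite_range u)
    refine hs.of_predim_eq_zero le_sup_left (isFG_sup_left.2 hfgu) ?_
    rw [predim_sup_left, predim, htd, ldim_span_eq_of_linIndepOver hu]; simp
  have hBeq : K ⊔ Submodule.span ℚ (range (Fin.append c u)) =
      (K ⊔ Submodule.span ℚ (range c)) ⊔ Submodule.span ℚ (range u) := by
    rw [ZilberHomogeneity.range_append, Submodule.span_union, ← sup_assoc]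
  -- the strong space is `Λ + ℚ(transport x̄)`, `Λ` the transport image of `B`
  have hΛX : (K ⊔ Submodule.span ℚ (range fun j => H.transport (Fin.append c u j))) ⊔
      Submodule.span ℚ (range fun j => H.transport (x j)) =
      K ⊔ Submodule.span ℚ (range fun j => H.transport (Fin.append (Fin.append c x) u j)) := by
    have h1 := H.sup_span_transport_comp_eq (y := Fin.append (Fin.append c x) u)
      (y' := Fin.append (Fin.append c u) x) (fun j => ?_) (fun j => ?_) ?_
    · rw [h1]
      have h2 : (fun i => H.transport (Fin.append (Fin.append c u) x i)) =
          Fin.append (fun j => H.transport (Fin.append c u j)) (fun j => H.transport (x j)) :=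
        transport_append_eq _ _ _
      rw [h2, ZilberHomogeneity.range_append, Submodule.span_union, ← sup_assoc]
    · refine Fin.addCases (fun i => ?_) (fun i => ?_) j
      · simpa only [Fin.append_left] using hcT i
      · simpa only [Fin.append_right] using huT i
    · refine Fin.addCases (fun i => ?_) (fun i => ?_) j
      · simpa only [Fin.append_left] using hcu i
      · simpa only [Fin.append_right] using hxT i
    · simp only [ZilberHomogeneity.range_append, Submodule.span_union]
      ac_rfl
  -- the Γ-isomorphisms `((c, u), x̄_{<j}, x̄ⱼ) ↦ (transports)` and `((c, u), x̄) ↦ (transports)`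
  have hindcu : LinIndepOver K (Fin.append c u) := hc.append hu
  have hindall : LinIndepOver K (Fin.append (Fin.append c u) x) := hindcu.append (by rwa [hBeq])
  have hisoall : IsGammaIso K (Fin.append (Fin.append c u) x)
      (Fin.append (fun j => H.transport (Fin.append c u j)) (fun j => H.transport (x j))) := by
    have := H.transfer (y := Fin.append (Fin.append c u) x) (fun j => by
      refine Fin.addCases (fun i => ?_) (fun i => ?_) j
      · simpa only [Fin.append_left] using hcu i
      · simpa only [Fin.append_right] using hxT i)
    rwa [transport_append_eq] at this
  -- `δ(transport x̄ / Λ) = δ(x̄ / B) ≥ 0`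
  have h0 : 0 ≤ predim (K ⊔ Submodule.span ℚ (range fun j => H.transport (Fin.append c u j)))
      (Submodule.span ℚ (range fun j => H.transport (x j))) := by
    rw [hisoall.predim_sup_span_eq hindall, hBeq]
    exact isStrong_iff.1 hB _ (isFG_span_of_finite _ (finite_range x))
  -- the chain condition transfers
  have hchain : ∀ j : Fin s, td ((K ⊔ Submodule.span ℚ (range fun j => H.transport (Fin.append c u j))) ⊔
      Submodule.span ℚ (range ((fun j => H.transport (x j)) ∘ Fin.castLE j.is_lt.le)))
      (Submodule.span ℚ {H.transport (x j)}) ≤ 1 := by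
    intro j
    have hsrc : td (((K ⊔ Submodule.span ℚ (range c)) ⊔ Submodule.span ℚ (range u)) ⊔
        Submodule.span ℚ (range (x ∘ Fin.castLE j.is_lt.le))) (Submodule.span ℚ {x j}) ≤ 1 :=
      td_span_singleton_le_one_of_mem_acl
        (acl_mono (gens_mono (le_sup_left.trans le_sup_left)) (hxacl j))
    have hisoj : IsGammaIso K (Fin.append (Fin.append (Fin.append c u) (x ∘ Fin.castLE j.is_lt.le)) ![x j])
        (Fin.append (Fin.append (fun k => H.transport (Fin.append c u k))
          (fun k => H.transport ((x ∘ Fin.castLE j.is_lt.le) k))) ![H.transport (x j)]) := by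
      have := H.transfer (y := Fin.append (Fin.append (Fin.append c u) (x ∘ Fin.castLE j.is_lt.le)) ![x j])
        (fun k => by
          refine Fin.addCases (fun i => ?_) (fun i => ?_) k
          · rw [Fin.append_left]
            refine Fin.addCases (fun i' => ?_) (fun i' => ?_) i
            · simpa only [Fin.append_left] using hcu i'
            · simpa only [Fin.append_right, Function.comp_apply] using hxT _
          · rw [Fin.append_right]
            fin_cases i
            simpa using hxT j)
      rw [transport_append_eq, transport_append_eq] at this
      convert this using 2
      funext i
      fin_cases i
      rfl
    have ht := hisoj.td_sup_span_eq
    rw [ZilberHomogeneity.range_single, ZilberHomogeneity.range_single, ZilberHomogeneity.range_append,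
      Submodule.span_union, ← sup_assoc, hBeq, ZilberHomogeneity.range_append, Submodule.span_union,
      ← sup_assoc] at ht
    have hfun : ((fun j => H.transport (x j)) ∘ Fin.castLE j.is_lt.le) =
        fun k => H.transport ((x ∘ Fin.castLE j.is_lt.le) k) := rfl
    rw [hfun, ← ht]
    exact hsrc
  have hS : IsStrong ((K ⊔ Submodule.span ℚ (range fun j => H.transport (Fin.append c u j))) ⊔
      Submodule.span ℚ (range fun j => H.transport (x j))) := by
    rw [hΛX]; exact hstrong
  exact IsStrong.of_sup_span_chain hS hchain h0

/-! ### Case 1: an algebraic or logarithmic element of `B ∖ A` -/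

/-- **Case 1 of the induction.** If some `x ∈ B ∖ A` is algebraic over `Γ(A)` or has `exp x`
algebraic over `Γ(A)`, the Γ-isomorphism extends by `x` (Lemma 3.26 / Prop. 3.22 via
`IsGammaIso.exists_append_single_of_mem_acl`, `IsGammaIso.exists_append_single_of_exp_mem_acl`),
the new bases are strong (Lemma 4.8), and `B` has a basis over `A + ℚx` of smaller length with
`δ = 0`. [cite: BaysKirby2018ANT, Lemma 3.26, Prop. 3.22, Lemma 4.8, Lemma 8.3 (proof)] -/
theorem exists_case1_reduct [IsAlgClosed F] (hK : IsGammaClosed K) (hsurj : IsSurjectiveOntoUnits F)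
    {c c' : Fin N → F} (hiso : IsGammaIso K c c') (hc : LinIndepOver K c)
    (hs : IsStrong (K ⊔ Submodule.span ℚ (range c)))
    (hs' : IsStrong (K ⊔ Submodule.span ℚ (range c'))) {u : Fin n → F}
    (hu : LinIndepOver (K ⊔ Submodule.span ℚ (range c)) u)
    (htd : td (K ⊔ Submodule.span ℚ (range c)) (Submodule.span ℚ (range u)) = n) {x : F}
    (hxB : x ∈ (K ⊔ Submodule.span ℚ (range c)) ⊔ Submodule.span ℚ (range u))
    (hxA : x ∉ K ⊔ Submodule.span ℚ (range c))
    (hx : x ∈ acl (gens (K ⊔ Submodule.span ℚ (range c))) ∨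
      exp x ∈ acl (gens (K ⊔ Submodule.span ℚ (range c)))) :
    ∃ (x' : F) (n₁ : ℕ) (u₁ : Fin n₁ → F), n₁ < n ∧
      IsGammaIso K (Fin.append c ![x]) (Fin.append c' ![x']) ∧
      LinIndepOver K (Fin.append c ![x]) ∧
      IsStrong (K ⊔ Submodule.span ℚ (range (Fin.append c ![x]))) ∧
      IsStrong (K ⊔ Submodule.span ℚ (range (Fin.append c' ![x']))) ∧
      LinIndepOver (K ⊔ Submodule.span ℚ (range (Fin.append c ![x]))) u₁ ∧
      td (K ⊔ Submodule.span ℚ (range (Fin.append c ![x]))) (Submodule.span ℚ (range u₁)) = n₁ ∧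
      (∀ j, u₁ j ∈ (K ⊔ Submodule.span ℚ (range c)) ⊔ Submodule.span ℚ (range u)) ∧
      (∀ j, u j ∈ (K ⊔ Submodule.span ℚ (range (Fin.append c ![x]))) ⊔ Submodule.span ℚ (range u₁)) := by
  classical
  -- the one-step extension and the strongness of the new bases
  have hstep : ∃ x' : F, IsGammaIso K (Fin.append c ![x]) (Fin.append c' ![x']) ∧
      IsStrong (K ⊔ Submodule.span ℚ (range (Fin.append c' ![x']))) := by
    rcases hx with hx | hx
    · obtain ⟨x', hx'acl, hx'A, hγ⟩ := hiso.exists_append_single_of_mem_acl hs hs' hx hxA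
      refine ⟨x', hγ, ?_⟩
      rw [sup_span_range_append_single]
      exact isStrong_sup_span_singleton_of_mem_acl hs' hx'acl hx'A
    · obtain ⟨x', hx'acl, hx'A, hγ⟩ := hiso.exists_append_single_of_exp_mem_acl hK hsurj hc hs hs' hx hxA
      refine ⟨x', hγ, ?_⟩
      rw [sup_span_range_append_single]
      exact isStrong_sup_span_singleton_of_exp_mem_acl hs' hx'acl hx'A
  obtain ⟨x', hγ, hs₁'⟩ := hstep
  have hA₁ : K ⊔ Submodule.span ℚ (range (Fin.append c ![x])) =
      (K ⊔ Submodule.span ℚ (range c)) ⊔ Submodule.span ℚ {x} := sup_span_range_append_single K c x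
  have htd1 : td (K ⊔ Submodule.span ℚ (range c)) (Submodule.span ℚ {x}) ≤ 1 := by
    rcases hx with hx | hx
    · exact td_span_singleton_le_one_of_mem_acl hx
    · exact td_span_singleton_le_one_of_exp_mem_acl hx
  have hδx : predim (K ⊔ Submodule.span ℚ (range c)) (Submodule.span ℚ {x}) = 0 :=
    (td_eq_one_and_predim_eq_zero_of_td_le_one hs hxA htd1).2
  have hs₁ : IsStrong (K ⊔ Submodule.span ℚ (range (Fin.append c ![x]))) := by
    rw [hA₁]
    exact hs.of_predim_eq_zero le_sup_left (isFG_sup_left.2 (isFG_span_of_finite _ (finite_singleton x)))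
      (by rwa [predim_sup_left])
  have hc₁ : LinIndepOver K (Fin.append c ![x]) := hc.append_single hxA
  -- a basis of `B` over `A + ℚx`
  obtain ⟨n₁, σ, hu₁, hu₁span⟩ := exists_linIndepOver_comp (K ⊔ Submodule.span ℚ (range (Fin.append c ![x]))) u
  have hBeq : (K ⊔ Submodule.span ℚ (range (Fin.append c ![x]))) ⊔ Submodule.span ℚ (range u) =
      (K ⊔ Submodule.span ℚ (range c)) ⊔ Submodule.span ℚ (range u) := by
    rw [hA₁]
    refine le_antisymm (sup_le (sup_le le_sup_left ((Submodule.span_singleton_le_iff_mem _ _).2 hxB)) le_sup_right) ?_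
    exact sup_le (le_sup_left.trans le_sup_left) le_sup_right
  -- dimensions
  have hfgu : IsFG (K ⊔ Submodule.span ℚ (range c)) (Submodule.span ℚ (range u)) :=
    isFG_span_of_finite _ (finite_range u)
  have hfgB : IsFG (K ⊔ Submodule.span ℚ (range c))
      ((K ⊔ Submodule.span ℚ (range (Fin.append c ![x]))) ⊔ Submodule.span ℚ (range u)) := by
    rw [hBeq]; exact isFG_sup_left.2 hfgu
  have hle₁ : K ⊔ Submodule.span ℚ (range c) ≤ K ⊔ Submodule.span ℚ (range (Fin.append c ![x])) := by
    rw [hA₁]; exact le_sup_left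
  have hldim := ldim_add hle₁ (le_sup_left : K ⊔ Submodule.span ℚ (range (Fin.append c ![x])) ≤
      (K ⊔ Submodule.span ℚ (range (Fin.append c ![x]))) ⊔ Submodule.span ℚ (range u)) hfgB
  have hl1 : ldim (K ⊔ Submodule.span ℚ (range c)) (K ⊔ Submodule.span ℚ (range (Fin.append c ![x]))) = 1 := by
    rw [hA₁, ldim_sup_left, ldim_span_singleton_of_not_mem hxA]
  have hl2 : ldim (K ⊔ Submodule.span ℚ (range (Fin.append c ![x])))
      ((K ⊔ Submodule.span ℚ (range (Fin.append c ![x]))) ⊔ Submodule.span ℚ (range u)) = n₁ := by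
    rw [← hu₁span, ldim_sup_left, ldim_span_eq_of_linIndepOver hu₁]
  have hl3 : ldim (K ⊔ Submodule.span ℚ (range c))
      ((K ⊔ Submodule.span ℚ (range (Fin.append c ![x]))) ⊔ Submodule.span ℚ (range u)) = n := by
    rw [hBeq, ldim_sup_left, ldim_span_eq_of_linIndepOver hu]
  rw [hl1, hl2, hl3] at hldim
  have hlt : n₁ < n := by omega
  have hδB : predim (K ⊔ Submodule.span ℚ (range c))
      ((K ⊔ Submodule.span ℚ (range (Fin.append c ![x]))) ⊔ Submodule.span ℚ (range u)) = 0 := by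
    rw [hBeq, predim_sup_left, predim, htd, ldim_span_eq_of_linIndepOver hu]; simp
  have hpadd := predim_add hle₁ (le_sup_left : K ⊔ Submodule.span ℚ (range (Fin.append c ![x])) ≤
      (K ⊔ Submodule.span ℚ (range (Fin.append c ![x]))) ⊔ Submodule.span ℚ (range u)) hfgB
  have hδ1 : predim (K ⊔ Submodule.span ℚ (range c)) (K ⊔ Submodule.span ℚ (range (Fin.append c ![x]))) = 0 := by
    rw [hA₁, predim_sup_left, hδx]
  rw [hδB, hδ1, zero_add] at hpadd
  have htd₁ : td (K ⊔ Submodule.span ℚ (range (Fin.append c ![x]))) (Submodule.span ℚ (range (u ∘ σ))) = n₁ := by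
    have h0 : predim (K ⊔ Submodule.span ℚ (range (Fin.append c ![x]))) (Submodule.span ℚ (range (u ∘ σ))) = 0 := by
      rw [← predim_sup_left, hu₁span]
      exact hpadd.symm
    rw [predim, ldim_span_eq_of_linIndepOver hu₁] at h0
    have hne : td (K ⊔ Submodule.span ℚ (range (Fin.append c ![x]))) (Submodule.span ℚ (range (u ∘ σ))) ≠ ⊤ :=
      td_ne_top (isFG_span_of_finite _ (finite_range _))
    rw [← ENat.coe_toNat hne]
    congr 1
    omega
  refine ⟨x', n₁, u ∘ σ, hlt, hγ, hc₁, hs₁, hs₁', hu₁, htd₁, fun j => ?_, fun j => ?_⟩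
  · exact Submodule.mem_sup_right (Submodule.subset_span ⟨σ j, rfl⟩)
  · rw [hu₁span]
    exact Submodule.mem_sup_right (Submodule.subset_span ⟨j, rfl⟩)

/-- Pulling the core output back along a Case-1 step. [folklore] -/
theorem corestep_of_case1 {c c' : Fin N → F} {u : Fin n → F} {x x' : F} {n₁ : ℕ} {u₁ : Fin n₁ → F}
    (hu₁B : ∀ j, u₁ j ∈ (K ⊔ Submodule.span ℚ (range c)) ⊔ Submodule.span ℚ (range u))
    (huB₁ : ∀ j, u j ∈ (K ⊔ Submodule.span ℚ (range (Fin.append c ![x]))) ⊔ Submodule.span ℚ (range u₁))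
    (hxB : x ∈ (K ⊔ Submodule.span ℚ (range c)) ⊔ Submodule.span ℚ (range u))
    {m : ℕ} {T T' : Fin m → F} (H : IsGammaIso K T T')
    (hcT : ∀ i, Fin.append c ![x] i ∈ K ⊔ Submodule.span ℚ (range T))
    (huT : ∀ j, u₁ j ∈ K ⊔ Submodule.span ℚ (range T))
    (hTc : ∀ i, H.transport (Fin.append c ![x] i) = Fin.append c' ![x'] i)
    (hstrong : IsStrong (K ⊔ Submodule.span ℚ (range fun j => H.transport (Fin.append (Fin.append c ![x]) u₁ j)))) :
    ∃ (m : ℕ) (T T' : Fin m → F) (H : IsGammaIso K T T'),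
      (∀ i, c i ∈ K ⊔ Submodule.span ℚ (range T)) ∧ (∀ j, u j ∈ K ⊔ Submodule.span ℚ (range T)) ∧
      (∀ i, H.transport (c i) = c' i) ∧
      IsStrong (K ⊔ Submodule.span ℚ (range fun j => H.transport (Fin.append c u j))) := by
  have hcT' : ∀ i, c i ∈ K ⊔ Submodule.span ℚ (range T) := fun i => by
    simpa only [Fin.append_left] using hcT (Fin.castAdd 1 i)
  have hxT : x ∈ K ⊔ Submodule.span ℚ (range T) := by
    simpa only [Fin.append_right, Matrix.cons_val_fin_one] using hcT (Fin.natAdd N 0)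
  have hA₁T : (K ⊔ Submodule.span ℚ (range (Fin.append c ![x]))) ⊔ Submodule.span ℚ (range u₁) ≤
      K ⊔ Submodule.span ℚ (range T) := by
    refine sup_le (sup_le le_sup_left (Submodule.span_le.2 ?_)) (Submodule.span_le.2 ?_)
    · rintro _ ⟨i, rfl⟩; exact hcT i
    · rintro _ ⟨j, rfl⟩; exact huT j
  have huT' : ∀ j, u j ∈ K ⊔ Submodule.span ℚ (range T) := fun j => hA₁T (huB₁ j)
  refine ⟨m, T, T', H, hcT', huT', fun i => ?_, ?_⟩
  · have := hTc (Fin.castAdd 1 i)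
    simpa only [Fin.append_left] using this
  · have heq : K ⊔ Submodule.span ℚ (range (Fin.append c u)) =
        K ⊔ Submodule.span ℚ (range (Fin.append (Fin.append c ![x]) u₁)) := by
      simp only [ZilberHomogeneity.range_append, ZilberHomogeneity.range_single, Submodule.span_union, ← sup_assoc]
      refine le_antisymm (sup_le (le_sup_left.trans le_sup_left) (Submodule.span_le.2 ?_))
        (sup_le (sup_le le_sup_left ((Submodule.span_singleton_le_iff_mem _ _).2 hxB)) (Submodule.span_le.2 ?_))
      · rintro _ ⟨j, rfl⟩
        have := huB₁ j
        rwa [sup_span_range_append_single] at this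
      · rintro _ ⟨j, rfl⟩; exact hu₁B j
    have hy1 : ∀ j, Fin.append c u j ∈ K ⊔ Submodule.span ℚ (range T) := by
      intro j
      refine Fin.addCases (fun i => ?_) (fun i => ?_) j
      · simpa only [Fin.append_left] using hcT' i
      · simpa only [Fin.append_right] using huT' i
    have hy2 : ∀ j, Fin.append (Fin.append c ![x]) u₁ j ∈ K ⊔ Submodule.span ℚ (range T) := by
      intro j
      refine Fin.addCases (fun i => ?_) (fun i => ?_) j
      · simpa only [Fin.append_left] using hcT i
      · simpa only [Fin.append_right] using huT i
    rw [H.sup_span_transport_comp_eq hy1 hy2 heq]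
    exact hstrong

/-! ### Case 2: the geometric exit -/

set_option maxHeartbeats 400000 in
/-- **Case 2 of the induction (geometric exit).** If no element of `B ∖ A` is algebraic over
`Γ(A)` or has algebraic exponential, and the Γ-field of the base is relatively algebraically
closed in the field generated by `(u, exp u)` over it, then the normalised basis
(`exists_relative_normalised_basis`) has a generic partner by generic strong Γ-closedness
(`exists_isGammaIso_append_of_gsgc`). [cite: BaysKirby2018ANT, Prop. 11.2, Thm 11.6 (proof)] -/
theorem corestep_of_case2 [IsAlgClosed F] (hK : IsGammaClosed K)
    (hG : IsGenericallyStronglyGammaClosedOver K) {c c' : Fin N → F} (hiso : IsGammaIso K c c')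
    (hc : LinIndepOver K c) (hs : IsStrong (K ⊔ Submodule.span ℚ (range c)))
    (hs' : IsStrong (K ⊔ Submodule.span ℚ (range c'))) {u : Fin n → F}
    (hu : LinIndepOver (K ⊔ Submodule.span ℚ (range c)) u)
    (htd : td (K ⊔ Submodule.span ℚ (range c)) (Submodule.span ℚ (range u)) = n)
    (hcase : ∀ z ∈ (K ⊔ Submodule.span ℚ (range c)) ⊔ Submodule.span ℚ (range u),
      (z ∈ acl (gens (K ⊔ Submodule.span ℚ (range c))) → z ∈ K ⊔ Submodule.span ℚ (range c)) ∧
      (exp z ∈ acl (gens (K ⊔ Submodule.span ℚ (range c))) → z ∈ K ⊔ Submodule.span ℚ (range c)))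
    (hrac : ∀ z ∈ IntermediateField.adjoin (fieldOf K) (allGens c ∪ range (gammaPt u)),
      IsAlgebraic (bfld K c) z → z ∈ bfld K c) :
    ∃ (m : ℕ) (T T' : Fin m → F) (H : IsGammaIso K T T'),
      (∀ i, c i ∈ K ⊔ Submodule.span ℚ (range T)) ∧ (∀ j, u j ∈ K ⊔ Submodule.span ℚ (range T)) ∧
      (∀ i, H.transport (c i) = c' i) ∧
      IsStrong (K ⊔ Submodule.span ℚ (range fun j => H.transport (Fin.append c u j))) := by
  classical
  -- normalise the basis
  have hmul : ∀ w : Fin n → ℤ, exp (∑ j, (w j : ℚ) • u j) ∈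
      IntermediateField.adjoin (fieldOf K) (allGens c) → w = 0 := by
    intro w hw
    by_contra hw0
    have hmem : ∑ j, (w j : ℚ) • u j ∈ (K ⊔ Submodule.span ℚ (range c)) ⊔ Submodule.span ℚ (range u) :=
      Submodule.mem_sup_right (Submodule.sum_mem _ fun j _ =>
        Submodule.smul_mem _ _ (Submodule.subset_span ⟨j, rfl⟩))
    have hA := (hcase _ hmem).2 (coe_bfld_subset_acl K c hw)
    exact hu.sum_intCast_smul_notMem hw0 hA
  obtain ⟨ut, hutspan, hutint, hfield, hkum⟩ := exists_relative_normalised_basis hK c hmul hrac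
  have hspan_eq : Submodule.span ℚ (range ut) = Submodule.span ℚ (range u) := by
    refine le_antisymm (Submodule.span_le.2 ?_) (Submodule.span_le.2 ?_)
    · rintro _ ⟨j, rfl⟩; exact hutspan j
    · rintro _ ⟨i, rfl⟩
      obtain ⟨z, hz⟩ := hutint i
      rw [hz]
      exact Submodule.sum_mem _ fun j _ => Submodule.smul_mem _ _ (Submodule.subset_span ⟨j, rfl⟩)
  have hut : LinIndepOver (K ⊔ Submodule.span ℚ (range c)) ut := hu.of_sup_span_eq (by rw [hspan_eq])
  have htdt : td (K ⊔ Submodule.span ℚ (range c)) (Submodule.span ℚ (range ut)) = n := by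
    rw [hspan_eq]; exact htd
  have hfree : ∀ m : Fin n → ℤ, m ≠ 0 →
      ∑ j, (m j : ℚ) • ut j ∉ acl (gens (K ⊔ Submodule.span ℚ (range c))) ∧
      exp (∑ j, (m j : ℚ) • ut j) ∉ acl (gens (K ⊔ Submodule.span ℚ (range c))) := by
    intro m hm
    have hmem : ∑ j, (m j : ℚ) • ut j ∈ (K ⊔ Submodule.span ℚ (range c)) ⊔ Submodule.span ℚ (range u) := by
      rw [← hspan_eq]
      exact Submodule.mem_sup_right (Submodule.sum_mem _ fun j _ =>
        Submodule.smul_mem _ _ (Submodule.subset_span ⟨j, rfl⟩))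
    have hnot := hut.sum_intCast_smul_notMem hm
    exact ⟨fun h => hnot ((hcase _ hmem).1 h), fun h => hnot ((hcase _ hmem).2 h)⟩
  have hrac' : ∀ z ∈ IntermediateField.adjoin (fieldOf K) (allGens c ∪ range (gammaPt ut)),
      IsAlgebraic (bfld K c) z → z ∈ bfld K c := fun z hz halg => hrac z (hfield ▸ hz) halg
  have hc' : LinIndepOver K c' := hiso.linIndepOver hc
  obtain ⟨g, hγ, hstrong'⟩ := exists_isGammaIso_append_of_gsgc hK hG hiso hc hc' hs hs' hut htdt hfree hrac' hkum
  -- the core output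
  have hcT : ∀ i, c i ∈ K ⊔ Submodule.span ℚ (range (Fin.append c ut)) := fun i =>
    Submodule.mem_sup_right (Submodule.subset_span ⟨Fin.castAdd n i, by simp⟩)
  have huT : ∀ j, u j ∈ K ⊔ Submodule.span ℚ (range (Fin.append c ut)) := by
    intro j
    have : u j ∈ Submodule.span ℚ (range ut) := by
      rw [hspan_eq]; exact Submodule.subset_span ⟨j, rfl⟩
    refine Submodule.mem_sup_right (Submodule.span_mono ?_ this)
    rintro _ ⟨i, rfl⟩; exact ⟨Fin.natAdd N i, by simp⟩
  refine ⟨N + n, Fin.append c ut, Fin.append c' g, hγ, hcT, huT, fun i => ?_, ?_⟩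
  · have := hγ.transport_apply (Fin.castAdd n i)
    simpa only [Fin.append_left] using this
  · have heq : K ⊔ Submodule.span ℚ (range (Fin.append c u)) = K ⊔ Submodule.span ℚ (range (Fin.append c ut)) := by
      rw [ZilberHomogeneity.range_append, ZilberHomogeneity.range_append, Submodule.span_union,
        Submodule.span_union, hspan_eq]
    have hutT : ∀ j, Fin.append c ut j ∈ K ⊔ Submodule.span ℚ (range (Fin.append c ut)) := fun j =>
      Submodule.mem_sup_right (Submodule.subset_span ⟨j, rfl⟩)
    have hy1 : ∀ j, Fin.append c u j ∈ K ⊔ Submodule.span ℚ (range (Fin.append c ut)) := by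
      intro j
      refine Fin.addCases (fun i => ?_) (fun i => ?_) j
      · simpa only [Fin.append_left] using hcT i
      · simpa only [Fin.append_right] using huT i
    rw [hγ.sup_span_transport_comp_eq hy1 hutT heq]
    have : (fun j => hγ.transport (Fin.append c ut j)) = Fin.append c' g := funext fun j => hγ.transport_apply j
    rw [this]
    exact hstrong'

/-! ### The induction -/

/-- **The core of Prop. 11.2** (induction on the linear dimension of `B/A`): for a
Γ-isomorphism `c ↦ c'` over the Γ-closed `K` between strong, linearly independent bases and a
basis `u` of a Γ-algebraic extension of `K + ℚc`, there is a Γ-isomorphism `T ↦ T'` over `K`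
whose domain span contains `c` and `u`, transporting `c ↦ c'`, with the transport image of
`K + ℚc + ℚu` strong in `F`. [cite: BaysKirby2018ANT, Prop. 11.2, Thm 11.6 (proof), Lemma 8.3 (proof)] -/
theorem corestep [IsAlgClosed F] (hK : IsGammaClosed K) (hsurj : IsSurjectiveOntoUnits F)
    (hG : IsGenericallyStronglyGammaClosedOver K) :
    ∀ (n : ℕ) {N : ℕ} {c c' : Fin N → F} (_hiso : IsGammaIso K c c') (_hc : LinIndepOver K c)
      (_hs : IsStrong (K ⊔ Submodule.span ℚ (range c)))
      (_hs' : IsStrong (K ⊔ Submodule.span ℚ (range c'))) {u : Fin n → F}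
      (_hu : LinIndepOver (K ⊔ Submodule.span ℚ (range c)) u)
      (_htd : td (K ⊔ Submodule.span ℚ (range c)) (Submodule.span ℚ (range u)) = n),
      ∃ (m : ℕ) (T T' : Fin m → F) (H : IsGammaIso K T T'),
        (∀ i, c i ∈ K ⊔ Submodule.span ℚ (range T)) ∧ (∀ j, u j ∈ K ⊔ Submodule.span ℚ (range T)) ∧
        (∀ i, H.transport (c i) = c' i) ∧
        IsStrong (K ⊔ Submodule.span ℚ (range fun j => H.transport (Fin.append c u j))) := by
  intro n
  induction n using Nat.strong_induction_on with
  | _ n ih =>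
    intro N c c' hiso hc hs hs' u hu htd
    classical
    by_cases h1 : ∃ x ∈ (K ⊔ Submodule.span ℚ (range c)) ⊔ Submodule.span ℚ (range u),
        x ∉ K ⊔ Submodule.span ℚ (range c) ∧
        (x ∈ acl (gens (K ⊔ Submodule.span ℚ (range c))) ∨ exp x ∈ acl (gens (K ⊔ Submodule.span ℚ (range c))))
    · -- Case 1
      obtain ⟨x, hxB, hxA, hx⟩ := h1
      obtain ⟨x', n₁, u₁, hlt, hγ, hc₁, hs₁, hs₁', hu₁, htd₁, hu₁B, huB₁⟩ :=
        exists_case1_reduct hK hsurj hiso hc hs hs' hu htd hxB hxA hx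
      obtain ⟨m, T, T', H, hcT, huT, hTc, hstr⟩ := ih n₁ hlt hγ hc₁ hs₁ hs₁' hu₁ htd₁
      exact corestep_of_case1 hu₁B huB₁ hxB H hcT huT hTc hstr
    · -- Case 2: absorb the relative algebraic closure
      push Not at h1
      have hcase : ∀ z ∈ (K ⊔ Submodule.span ℚ (range c)) ⊔ Submodule.span ℚ (range u),
          (z ∈ acl (gens (K ⊔ Submodule.span ℚ (range c))) → z ∈ K ⊔ Submodule.span ℚ (range c)) ∧
          (exp z ∈ acl (gens (K ⊔ Submodule.span ℚ (range c))) → z ∈ K ⊔ Submodule.span ℚ (range c)) := by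
        intro z hz
        constructor
        · intro hzacl; by_contra hzA; exact (h1 z hz hzA).1 hzacl
        · intro hzacl; by_contra hzA; exact (h1 z hz hzA).2 hzacl
      obtain ⟨s, x, x', hγ, hxacl, hxind, hs₂, hs₂', hu₂, htd₂, hrac⟩ :=
        exists_absorb hiso hs hs' hu htd (fun z hz hzacl => (hcase z hz).1 hzacl)
      have hc₂ : LinIndepOver K (Fin.append c x) := hc.append (hxind.of_le le_sup_left)
      -- the core output for the enlarged base, then descent
      have hout : ∃ (m : ℕ) (T T' : Fin m → F) (H : IsGammaIso K T T'),
          (∀ i, Fin.append c x i ∈ K ⊔ Submodule.span ℚ (range T)) ∧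
          (∀ j, u j ∈ K ⊔ Submodule.span ℚ (range T)) ∧
          (∀ i, H.transport (Fin.append c x i) = Fin.append c' x' i) ∧
          IsStrong (K ⊔ Submodule.span ℚ (range fun j => H.transport (Fin.append (Fin.append c x) u j))) := by
        by_cases h2 : ∃ y ∈ (K ⊔ Submodule.span ℚ (range (Fin.append c x))) ⊔ Submodule.span ℚ (range u),
            y ∉ K ⊔ Submodule.span ℚ (range (Fin.append c x)) ∧
            (y ∈ acl (gens (K ⊔ Submodule.span ℚ (range (Fin.append c x)))) ∨
              exp y ∈ acl (gens (K ⊔ Submodule.span ℚ (range (Fin.append c x)))))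
        · obtain ⟨y, hyB, hyA, hy⟩ := h2
          obtain ⟨y', n₁, u₁, hlt, hγ₁, hc₁, hs₁, hs₁', hu₁, htd₁, hu₁B, huB₁⟩ :=
            exists_case1_reduct hK hsurj hγ hc₂ hs₂ hs₂' hu₂ htd₂ hyB hyA hy
          obtain ⟨m, T, T', H, hcT, huT, hTc, hstr⟩ := ih n₁ hlt hγ₁ hc₁ hs₁ hs₁' hu₁ htd₁
          exact corestep_of_case1 hu₁B huB₁ hyB H hcT huT hTc hstr
        · push Not at h2
          have hcase₂ : ∀ z ∈ (K ⊔ Submodule.span ℚ (range (Fin.append c x))) ⊔ Submodule.span ℚ (range u),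
              (z ∈ acl (gens (K ⊔ Submodule.span ℚ (range (Fin.append c x)))) →
                z ∈ K ⊔ Submodule.span ℚ (range (Fin.append c x))) ∧
              (exp z ∈ acl (gens (K ⊔ Submodule.span ℚ (range (Fin.append c x)))) →
                z ∈ K ⊔ Submodule.span ℚ (range (Fin.append c x))) := by
            intro z hz
            constructor
            · intro hzacl; by_contra hzA; exact (h2 z hz hzA).1 hzacl
            · intro hzacl; by_contra hzA; exact (h2 z hz hzA).2 hzacl
          exact corestep_of_case2 hK hG hγ hc₂ hs₂ hs₂' hu₂ htd₂ hcase₂ hrac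
      obtain ⟨m, T, T', H, hcT, huT, hTc, hstr⟩ := hout
      exact corestep_of_absorb hc hs hu htd hxacl hxind H hcT huT hTc hstr

end GammaField

/-! ### Prop. 11.2 -/

open GammaField Literature.ModelTheory.ExponentialFields.ExponentialRing ZilberSaturationMain in
/-- **Bays–Kirby 2018, Prop. 11.2** ("GSΓC gives `ℵ₀`-saturation for Γ-algebraic extensions over
`K`"), proof of the named fact `Literature.NumberTheory.Transcendental.BaysKirby2018_prop_11_2`: extract bases of `K + ℚc` over
`K` and of `K + ℚc + ℚe` over `K + ℚc`, run the induction `GammaField.corestep`, and transport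
`e` along the resulting Γ-isomorphism. [cite: BaysKirby2018ANT, Prop. 11.2] -/
theorem BaysKirby2018_prop_11_2_holds : BaysKirby2018_prop_11_2 := by
  intro F _ _ _ hF hsurj K hK _ _ hG N k c c' e hs hs' hiso hδ
  classical
  haveI := hF
  -- a basis of `K + ℚc` over `K`
  obtain ⟨N₀, σ, hc₀, hA⟩ := exists_linIndepOver_comp K c
  have hiso₀ : IsGammaIso K (c ∘ σ) (c' ∘ σ) := by
    have := hiso.transfer (y := c ∘ σ) fun j => Submodule.mem_sup_right (Submodule.subset_span ⟨σ j, rfl⟩)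
    have heq : (fun j => hiso.transport ((c ∘ σ) j)) = c' ∘ σ := funext fun j => hiso.transport_apply _
    rwa [heq] at this
  have hs₀ : IsStrong (K ⊔ Submodule.span ℚ (range (c ∘ σ))) := by rw [hA]; exact hs
  have hA' : K ⊔ Submodule.span ℚ (range (c' ∘ σ)) = K ⊔ Submodule.span ℚ (range c') := by
    have h1 := hiso.sup_span_transport_eq (y := c ∘ σ)
      (fun j => Submodule.mem_sup_right (Submodule.subset_span ⟨σ j, rfl⟩))
      (fun i => by rw [hA]; exact Submodule.mem_sup_right (Submodule.subset_span ⟨i, rfl⟩))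
    have heq : (fun j => hiso.transport ((c ∘ σ) j)) = c' ∘ σ := funext fun j => hiso.transport_apply _
    rwa [heq] at h1
  have hs₀' : IsStrong (K ⊔ Submodule.span ℚ (range (c' ∘ σ))) := by rw [hA']; exact hs'
  -- a basis of `B` over `A`
  obtain ⟨n, τ, hu, hB⟩ := exists_linIndepOver_comp (K ⊔ Submodule.span ℚ (range (c ∘ σ))) e
  have hfge : IsFG (K ⊔ Submodule.span ℚ (range (c ∘ σ))) (Submodule.span ℚ (range e)) :=
    isFG_span_of_finite _ (finite_range e)
  have htd : td (K ⊔ Submodule.span ℚ (range (c ∘ σ))) (Submodule.span ℚ (range (e ∘ τ))) = n := by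
    have hl : ldim (K ⊔ Submodule.span ℚ (range (c ∘ σ))) (Submodule.span ℚ (range (e ∘ τ))) = n :=
      ldim_span_eq_of_linIndepOver hu
    have hl' : ldim (K ⊔ Submodule.span ℚ (range (c ∘ σ))) (Submodule.span ℚ (range e)) = n := by
      rw [← ldim_sup_left, ← hB, ldim_sup_left, hl]
    have ht : td (K ⊔ Submodule.span ℚ (range (c ∘ σ))) (Submodule.span ℚ (range (e ∘ τ))) =
        td (K ⊔ Submodule.span ℚ (range (c ∘ σ))) (Submodule.span ℚ (range e)) := by
      rw [← td_sup_left, hB, td_sup_left]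
    have h0 : predim (K ⊔ Submodule.span ℚ (range (c ∘ σ))) (Submodule.span ℚ (range e)) = 0 := by
      rw [hA]; exact hδ
    rw [predim, hl'] at h0
    rw [ht]
    have hne : td (K ⊔ Submodule.span ℚ (range (c ∘ σ))) (Submodule.span ℚ (range e)) ≠ ⊤ :=
      td_ne_top (isFG_span_of_finite _ (finite_range e))
    rw [← ENat.coe_toNat hne]
    congr 1
    omega
  obtain ⟨m, T, T', H, hcT, huT, hTc, hstrong⟩ := corestep hK hsurj hG n hiso₀ hc₀ hs₀ hs₀' hu htd
  -- memberships
  have hA_le : K ⊔ Submodule.span ℚ (range c) ≤ K ⊔ Submodule.span ℚ (range T) := by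
    rw [← hA]
    refine sup_le le_sup_left (Submodule.span_le.2 ?_)
    rintro _ ⟨j, rfl⟩; exact hcT j
  have hcT' : ∀ i, c i ∈ K ⊔ Submodule.span ℚ (range T) := fun i =>
    hA_le (Submodule.mem_sup_right (Submodule.subset_span ⟨i, rfl⟩))
  have hle' : (K ⊔ Submodule.span ℚ (range (c ∘ σ))) ⊔ Submodule.span ℚ (range (e ∘ τ)) ≤
      K ⊔ Submodule.span ℚ (range T) := by
    refine sup_le (hA.le.trans hA_le) (Submodule.span_le.2 ?_)
    rintro _ ⟨i, rfl⟩; exact huT i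
  have heT : ∀ j, e j ∈ K ⊔ Submodule.span ℚ (range T) := by
    intro j
    have : e j ∈ (K ⊔ Submodule.span ℚ (range (c ∘ σ))) ⊔ Submodule.span ℚ (range e) :=
      Submodule.mem_sup_right (Submodule.subset_span ⟨j, rfl⟩)
    rw [← hB] at this
    exact hle' this
  -- the transport agrees with `c ↦ c'` on `A`
  have hTc' : ∀ i, H.transport (c i) = c' i := by
    intro i
    have hci : c i ∈ K ⊔ Submodule.span ℚ (range (c ∘ σ)) := by
      rw [hA]; exact Submodule.mem_sup_right (Submodule.subset_span ⟨i, rfl⟩)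
    have h1 : hiso₀.transport (c i) = H.transport (c i) :=
      hiso₀.transport_eq_transport H hcT hTc hci
    have h2 : hiso₀.transport (c i) = hiso.transport (c i) :=
      hiso₀.transport_eq_transport hiso
        (fun j => Submodule.mem_sup_right (Submodule.subset_span ⟨σ j, rfl⟩))
        (fun j => hiso.transport_apply _) hci
    rw [← h1, h2, hiso.transport_apply]
  have hy1 : ∀ j, Fin.append c e j ∈ K ⊔ Submodule.span ℚ (range T) := by
    intro j
    refine Fin.addCases (fun i => ?_) (fun i => ?_) j
    · simpa only [Fin.append_left] using hcT' i
    · simpa only [Fin.append_right] using heT i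
  have hy2 : ∀ j, Fin.append (c ∘ σ) (e ∘ τ) j ∈ K ⊔ Submodule.span ℚ (range T) := by
    intro j
    refine Fin.addCases (fun i => ?_) (fun i => ?_) j
    · simpa only [Fin.append_left] using hcT i
    · simpa only [Fin.append_right] using huT i
  refine ⟨fun j => H.transport (e j), ?_, ?_⟩
  · have := H.transfer (y := Fin.append c e) hy1
    rw [transport_append_eq] at this
    have heq : (fun i => H.transport (c i)) = c' := funext hTc'
    rwa [heq] at this
  · have h1 : Fin.append c' (fun j => H.transport (e j)) = fun j => H.transport (Fin.append c e j) := by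
      rw [transport_append_eq]
      congr 1
      exact (funext hTc').symm
    have heq : K ⊔ Submodule.span ℚ (range (Fin.append c e)) =
        K ⊔ Submodule.span ℚ (range (Fin.append (c ∘ σ) (e ∘ τ))) := by
      rw [ZilberHomogeneity.range_append, ZilberHomogeneity.range_append, Submodule.span_union,
        Submodule.span_union, ← sup_assoc, ← sup_assoc, ← hA, hB, hA]
    rw [h1, H.sup_span_transport_comp_eq hy1 hy2 heq]
    exact hstrong



end Literature.NumberTheory.Transcendental
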